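import Summits.QuantumFields.YangMills.Theorems.InfiniteVolumeContinuumIVEuclideanInvarianceGermReduction
import Summits.QuantumFields.YangMills.Theorems.InfiniteVolumeTorusScheme
import Summits.QuantumFields.YangMills.Theorems.InfiniteVolumeCentreBase
import Summits.QuantumFields.YangMills.Theorems.LangevinControlUVOSLegsFromFemtoAndGapStubAssemblyDensityExpansion
import HarnessLib

/-!
# Route `InfiniteVolumeContinuum`, support `IVEuclideanInvariance` (stmt-QuantumFields-19933): stub `stub_ivGerm` (W3)
# — det-1 planar germ invariance of the infinite-volume-first continuum data from the lattice rotation Ward identities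

Lead seat `ym-infvol-p1` (R136 (i)); registered stub W3 of the skeleton `IVEuclideanInvariance_proof` (v2, evidence #2
on 19933).  HONEST FRAMING: existence half only, conditional on Track A's `BalabanLadder.UV`; `MomentBounds6` and
`LatticeRotWard` (= the spine's `ROT` by name) are HYPOTHESES; nothing about Yang–Mills is asserted; not a gap, not Clay.

`stub_ivGerm`: for every tuple `(β, μ, S₁, T)` satisfying the route's DATA clause in a positive unit `a → 0` carrying
`MomentBounds6 G r a` and `LatticeRotWard G r a`, and with `OffDiagDensity S₁` (stub W2), there is `r₁ > 0` such that
every det-1 isometry of the `(x₀,x₁)`-plane fixes `S₁` on off-diagonal tests of diameter `< r₁`.  Assembly BY NAME: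
seat p2's junction `exists_torusSides_approximating` (torus sides `L_k ≥ a_k⁻²` along a tail of the data with the spine's
torus string functionals `latticeDistStr` asymptotic to the BASE-point infinite-volume series), seat p2's
`tendsto_base_of_tendsto_centre` (the DATA clause's CENTRE-smeared series and the base-point series have the same limits),
the toolkit identity `latticeDist_dens_eq_sum_latticeDistStr` (density functional = sum of the string functionals over
the valid orientation strings) and the convention `S₁ n = Σ_q T n q` give the torus approximation
`latticeDist(β_k, L_k, a(β_k)) n F → S₁ n F` on `⁰𝒮`; then `germ_of_latticeRotWard_of_torusApprox` (this seat: the tail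
is an admissible scheme, the Ward defect vanishes along it by `LatticeRotWard`, uniqueness of limits, King's mechanism
`GermWard.germInvariant_planeRot_of_ward`).

References: C. King, CMP 103 (1986) 323–349, Thm 2.4; K. Osterwalder, R. Schrader, CMP 31 (1973).
-/

set_option autoImplicit false

noncomputable section

open MeasureTheory Filter Topology
open scoped BigOperators SchwartzMap
open Literature.MathematicalPhysics.QuantumFieldTheory hiding ZdEdge
open Literature.MathematicalPhysics.QuantumLattice
open Literature.MathematicalPhysics.AQFT
open Literature.Probability.LatticeModels (Site)
open Summit.QuantumFields.YangMills.Cruxes.OSLegsFromFemtoAndGap.DlrCollarTransfer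
open Summit.QuantumFields.YangMills.Cruxes.OSLegsAtWeakCouplingC.Sketch (IsPlanar01 OffDiagDensity GermInvariant)
open Summit.QuantumFields.YangMills.Cruxes.OSLegsAtWeakCouplingC.Y2Bridge (LatticeRotWard)
open Summit.QuantumFields.YangMills.Theorems.OSLegsFromFemtoAndGap
  (latticeDist latticeDistStr latticeDist_dens_eq_sum_latticeDistStr)

namespace Summit.QuantumFields.YangMills.Theorems.InfiniteVolume.E1

variable {G : Type} [Group G] [TopologicalSpace G] [IsTopologicalGroup G] [CompactSpace G]
  [MeasurableSpace G] [BorelSpace G]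

/-- **W3 — det-1 planar germ invariance from `LatticeRotWard` along the DATA clause** (registered stub `stub_ivGerm` of
the skeleton of `IVEuclideanInvariance`, stmt-QuantumFields-19933). [folklore] -/
theorem stub_ivGerm (r : LatticeRep G) (a : ℝ → ℝ) (β : ℕ → ℝ) (μ : ℕ → Measure (LGConfig 4 G))
    (S₁ : SchwingerFamily (EuclideanSpace ℝ (Fin 4))) (T : (n : ℕ) → (Fin n → Fin 4 × Fin 4) → (𝓢((Fin n → EuclideanSpace ℝ (Fin 4)), ℂ) →L[ℂ] ℂ))
    (hapos : ∀ b, 0 < a b) (ha0 : Tendsto a atTop (𝓝 0)) (hMB : MomentBounds6 G r a) (hROT : LatticeRotWard G r a)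
    (hβ : Tendsto β atTop atTop) (hμ : ∀ k, μ k ∈ oddTorusLimitPoints r (β k))
    (h1 : ∀ F : 𝓢((Fin 1 → EuclideanSpace ℝ (Fin 4)), ℂ), S₁ 1 F = 0)
    (hS : ∀ n : ℕ, 2 ≤ n → ∀ F : 𝓢((Fin n → EuclideanSpace ℝ (Fin 4)), ℂ), S₁ n F = ∑ q ∈ Fintype.piFinset (fun _ : Fin n => Finset.univ.filter fun p : Fin 4 × Fin 4 => p.1 < p.2), T n q F)
    (hT : ∀ n : ℕ, 2 ≤ n → ∀ q : Fin n → Fin 4 × Fin 4, (∀ i, (q i).1 < (q i).2) →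
      ∀ F : 𝓢((Fin n → EuclideanSpace ℝ (Fin 4)), ℂ), IsOffDiagonal F →
        Tendsto (fun k => ∑' x : Fin n → (Fin 4 → ℤ), ((stateMomentStr G r (μ k) n q x : ℝ) : ℂ) *
          F (fun l => a (β k) • siteToE (x l) + (a (β k) / 2) •
            (EuclideanSpace.single (q l).1 (1 : ℝ) + EuclideanSpace.single (q l).2 (1 : ℝ)))) atTop (𝓝 (T n q F)))
    (hdens : OffDiagDensity S₁) :
    ∃ r₁ : ℝ, 0 < r₁ ∧ ∀ R : EuclideanSpace ℝ (Fin 4) ≃ₗᵢ[ℝ] EuclideanSpace ℝ (Fin 4), LinearMap.det (R.toLinearEquiv : EuclideanSpace ℝ (Fin 4) →ₗ[ℝ] EuclideanSpace ℝ (Fin 4)) = 1 → IsPlanar01 R →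
      GermInvariant S₁ R r₁ := by
  classical
  -- thresholds of seat p2's junction, and a tail of the data inside them
  obtain ⟨β₀, ℓ₀, hℓ₀, HJ⟩ := exists_torusSides_approximating r hMB
  obtain ⟨k₁, hk₁⟩ : ∃ k₁ : ℕ, ∀ k, k₁ ≤ k → β₀ ≤ β k ∧ a (β k) ≤ 1 / 24 ∧ a (β k) ≤ ℓ₀ := by
    have e1 : ∀ᶠ k in atTop, β₀ ≤ β k := hβ.eventually_ge_atTop β₀
    have e2 : ∀ᶠ k in atTop, a (β k) ≤ 1 / 24 :=
      (ha0.comp hβ).eventually (ge_mem_nhds (by norm_num : (0 : ℝ) < 1 / 24))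
    have e3 : ∀ᶠ k in atTop, a (β k) ≤ ℓ₀ := (ha0.comp hβ).eventually (ge_mem_nhds hℓ₀)
    obtain ⟨k₁, hk₁⟩ := (e1.and (e2.and e3)).exists_forall_of_atTop
    exact ⟨k₁, hk₁⟩
  set β' : ℕ → ℝ := fun k => β (k + k₁) with hβ'def
  set μ' : ℕ → Measure (LGConfig 4 G) := fun k => μ (k + k₁) with hμ'def
  have hβ' : Tendsto β' atTop atTop := hβ.comp (tendsto_add_atTop_nat k₁)
  have hμ' : ∀ k, μ' k ∈ oddTorusLimitPoints r (β' k) := fun k => hμ _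
  have htail : ∀ k, β₀ ≤ β' k ∧ a (β' k) ≤ 1 / 24 ∧ a (β' k) ≤ ℓ₀ := fun k => hk₁ (k + k₁) (Nat.le_add_left _ _)
  obtain ⟨L, -, hL, -, hJ⟩ := HJ β' (fun k => (htail k).1) (fun k => hapos _) (fun k => (htail k).2.1)
    (fun k => (htail k).2.2) μ' hμ' (fun _ => 0)
  -- the torus density functionals along the tail converge to `S₁ n F` on `⁰𝒮`
  have hconvT : ∀ n : ℕ, 2 ≤ n → ∀ F : 𝓢((Fin n → EuclideanSpace ℝ (Fin 4)), ℂ), IsOffDiagonal F →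
      Tendsto (fun k => latticeDist r.ρ (β' k) (L k) (a (β' k)) r.curvature.F
        (wilsonTorusMean r.ρ (β' k) (L k) r.curvature.F) n F) atTop (𝓝 (S₁ n F)) := by
    intro n hn F hF
    rw [hS n hn F]
    have hrw : (fun k => latticeDist r.ρ (β' k) (L k) (a (β' k)) r.curvature.F
        (wilsonTorusMean r.ρ (β' k) (L k) r.curvature.F) n F) = fun k =>
        ∑ q ∈ Fintype.piFinset (fun _ : Fin n => Finset.univ.filter fun p : Fin 4 × Fin 4 => p.1 < p.2),
          latticeDistStr r.ρ (β' k) (L k) (a (β' k)) (fun i U => plaquetteObs r.ρ 0 (q i).1 (q i).2 U)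
            (fun i => wilsonTorusMean r.ρ (β' k) (L k) (fun U => plaquetteObs r.ρ 0 (q i).1 (q i).2 U)) F :=
      funext fun k => latticeDist_dens_eq_sum_latticeDistStr r _ _ _ n F
    rw [hrw]
    refine tendsto_finsetSum _ fun q hq => ?_
    have hqv : ∀ i, (q i).1 < (q i).2 := fun i => by
      rw [Fintype.mem_piFinset] at hq
      exact (Finset.mem_filter.1 (hq i)).2
    -- base-point series → `T n q F` (seat p2's centre ↔ base), torus strings asymptotic to it (the junction)
    have hbase : Tendsto (fun k => ∑' x : Fin n → (Fin 4 → ℤ), ((stateMomentStr G r (μ' k) n q x : ℝ) : ℂ) *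
        F (fun l => a (β' k) • siteToE (x l))) atTop (𝓝 (T n q F)) :=
      tendsto_base_of_tendsto_centre r hapos ha0 hMB β' hβ' μ' hμ' hn q hqv F hF
        ((hT n hn q hqv F hF).comp (tendsto_add_atTop_nat k₁))
    have hdiff := hJ n hn q hqv F hF
    have hsum := hdiff.add hbase
    rw [zero_add] at hsum
    refine hsum.congr fun k => ?_
    simp only [stateMomentStr, hμ'def, hβ'def, sub_add_cancel]
  exact germ_of_latticeRotWard_of_torusApprox r a β' L S₁ hapos ha0 hROT hβ' hL h1 hdens hconvT

end Summit.QuantumFields.YangMills.Theorems.InfiniteVolume.E1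

end
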